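import Mathlib
import Summits.HodgeConjecture.FermatCycles.HodgeFermatFiveThreeFinal
import Summits.HodgeConjecture.FermatCycles.HodgeFermatThmFstar
import Summits.HodgeConjecture.FermatCycles.HodgeFermatPropDPrimeNFinal
import Summits.HodgeConjecture.FermatCycles.HodgeFermatPropDPrimePrimeStatement

/-!
# PROPOSITION D′ at the prime levels `3p`, `p ≥ 11`, `p ≠ 13` (`HodgeFermat/DecodingDPrime.lean` + `DPrimePrimeFinal.lean`; HF-G32); closes the statement `PropDPrimePrime`

Tree copy of 2 SMALL MODULES of the sibling cell's standalone package `run/shared/lean/pub/pub-hodgefermat/lean/HodgeFermat/`,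
concatenated IN DEPENDENCY ORDER in one tree file (each module's body byte-identical to its source lines, its own
`namespace … end` block kept; the precedent is `HodgeFermatPropDPrimeNFinal.lean`):
  1. `HodgeFermat/DecodingDPrime.lean` (66 lines, sha256 `051f08884befa416…`), whole module, source lines 21–66 (all:
     `propDprime_prime` — PROPOSITION D′ at the prime levels under `KR6'`, `ThmUPlus'` and THEOREM F*(3p) as the hypothesis `hF` —,
     `not_sameType`) — pub-hodgefermat `CERT.md` l.978, GATE HF-G32; cell records `check/DecodingDPrime_standalone.lean` sha256
     `668d60b860fbbaa5…` rc 0 (74.5 s) = split pair `check/DecodingDPrime_link_standalone.lean` `591110a937ea4979…` rc 0 +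
     `check/DecodingDPrime_part1_standalone.lean` `e147557e91070793…` rc 0, axioms [propext, Classical.choice, Quot.sound];
  2. `HodgeFermat/DPrimePrimeFinal.lean` (38 lines, sha256 `194279f6de31b0a3…`), whole module + the closing theorem, source
     lines 18–38 (all: `propDprime_prime` — the composition with THEOREM F*(3p) `DecodingFinal.thmFstar`, hypotheses `KR6'`,
     `ThmUPlus'` only) + `propDprimePrime_holds : PropDPrimePrime` — GATE HF-G32; lake-only in the sibling (its one-file
     concatenation exceeds the hub cap), here an ordinary module on top of the landed chains.
Filed by cell `pub-hfermat`, seat prover-1 gen-4, on the COORDINATOR KEEPER RULING of 2026-08-25 (gem sweep H1: take the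
off-gate kernel theorem `thmFstar` through the gate).  The three forms of THEOREM F* named `thmFstar` in the sibling package are
on-gate since 2026-08-25/26 (`HodgeFermatThmFstar.lean` = F* at the prime levels, HF-G32, seat gen-0; `HodgeFermatThmFstarN.lean` =
F*(3N), HF-G33, gen-2; `HodgeFermatPropDPrimeNFinal.lean` = PROPOSITION D′(3N) and THE DESCENT, HF-G34, gen-3); this generation
files the two remaining off-gate companions of that family: PROPOSITION D′ at the prime levels (the second theorem of the HF-G32
gate record itself, `DecodingDPrime` / `DPrimePrimeFinal`) and THE DESCENT AT THE LEVELS 15N AND 21N (HF-G34b, `DescentB` /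
`DescentBFinal`).
Deviations from the source modules, exhaustively: the `import` lines (tree modules `Summits.HodgeConjecture.FermatCycles.HodgeFermat*`
instead of `HodgeFermat.*`, hoisted to the top: `…HodgeFermatFiveThreeFinal` for `import HodgeFermat.ThreeFinal`, `…HodgeFermatThmFstar`
for `import HodgeFermat.DecodingFinal`, module 1 in this very file for `import HodgeFermat.DecodingDPrime`; `…HodgeFermatPropDPrimeNFinal`
and `…HodgeFermatPropDPrimePrimeStatement` serve the closing theorem only); this docstring (replacing the modules' docstrings, both
quoted below); module 1: none besides these; module 2: AFTER the source's last declaration and before its `end` line ONE theorem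
is added: `propDprimePrime_holds : PropDPrimePrime` — the statement filed first (`HodgeFermatPropDPrimePrimeStatement.lean`, the
universal closure of `propDprime_prime`'s signature after `KR6'`, `ThmUPlus'`) closed by `propDprime_prime` with THEOREM KR6
`TheoremZ3U.kr6'` and THEOREM U⁺ `PropDPrimeNFinal.thmUPlus'` (landed, `HodgeFermatPropDPrimeNFinal.lean`) substituted for its two
hypotheses — a re-packaging with no mathematical content, literally the sibling's own discharge pattern (`DescentBFinal.lean` l.44).
Every other line — in particular every declaration's statement and proof — is byte-identical to its source.
Trust base: no hypotheses in `propDprimePrime_holds`, no `sorry`; axioms = [propext, Classical.choice, Quot.sound].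
HONEST FRAMING: explicit algebraic cycles for specific Hodge classes on Fermat/Delsarte varieties; residual open instances
listed; no claim on general Hodge.  (This file is arithmetic of CM types / finite combinatorics of the sibling's KR-free
programme; it claims nothing about cycles.)

(1) The docstring of `HodgeFermat/DecodingDPrime.lean` (l.3–19), verbatim:

## PROPOSITION D′ at the prime levels 3p, p ≥ 11, p ≠ 13, from THEOREM F*(3p) and COROLLARY M (HF-G32)

PROPOSITION D′ (`tables/DPRIME-THEOREM.md` §1): two DISJOINT, JOINTLY PRIMITIVE zero-sum triples mod `m` (no entry
`≡ 0`) of the same CM type force `m ∈ {15, 21, 33, 39}`.  At a prime level `m = 3p`, `p ≥ 11`, `p ≠ 13`: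
* COROLLARY M in final form (`ThreeFinal.corollaryM_final`, under THEOREM KR6 `KR6'` and THEOREM U⁺ `ThmUPlus'`), clause
  "no prime `q ≥ 7` of `m` divides an entry", says that all six entries are prime to `p`;
* THEOREM F*(3p) (`Decoding.thmFstar` from `H0`; `DecodingFinal.thmFstar` unconditionally) says that two disjoint
  zero-sum triples mod `3p` with entries prime to `p` never have the same CM type.
Hence PROPOSITION D′ holds at every prime level `3p`, `p ≥ 11`, `p ≠ 13`, under `KR6'`, `ThmUPlus'` — `propDprime_prime` below, with
THEOREM F*(3p) entering as the explicit hypothesis `hF` (its statement verbatim), so that this module stays on the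
COROLLARY M side of the import graph (hub record `check/DecodingDPrime_standalone.lean`, 24 bodies: ThreeFinal's 23 +
this; the 27-body record of `DecodingFinal.thmFstar` discharges `hF`; the two records together exceed the hub's one-file
cap, so the two-line composition `propDprime_prime hKR hUplus hp hp11 (DecodingFinal.thmFstar hp hp11 hp13)` is left to
`lake build` / the reader).  LIGHT module (imports `ThreeFinal`).  No `sorry`; no `decide`; axioms [propext,
Classical.choice, Quot.sound].  NOT imported by the root `HodgeFermat.lean`.

(2) The docstring of `HodgeFermat/DPrimePrimeFinal.lean` (l.4–16), verbatim:

## PROPOSITION D′ at the prime levels 3p, p ≥ 11, p ≠ 13 — the composition (HF-G32; `lake build` form)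

`DecodingDPrime.propDprime_prime` (COROLLARY M side: `KR6'`, `ThmUPlus'`, and THEOREM F*(3p) as a hypothesis `hF`) composed
with `DecodingFinal.thmFstar` (the analytic side: THEOREM F*(3p) unconditionally).  The result: under THEOREM KR6 and
THEOREM U⁺ (the two standing hypotheses of COROLLARY M, both proved in this package in their `…Final` modules' sense),
two disjoint jointly primitive zero-sum triples mod `3p`, `p ≥ 11`, `p ≠ 13` prime, with no entry `≡ 0`, never have the same CM type —
PROPOSITION D′ of `tables/DPRIME-THEOREM.md` at every prime level.  This module's import closure is the union of the
COROLLARY M cone (23 modules) and the analytic chain (26 modules); its one-file concatenation exceeds the hub's 512 KiB cap,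
so it has NO hub record: it is a two-line composition of the two hub-checked records `check/DecodingDPrime_standalone.lean`
and `check/DecodingFinal_standalone.lean`, checked by `lake build HodgeFermat.DPrimePrimeFinal` only.
NOT imported by the root `HodgeFermat.lean`.
-/

/-! ## Module 1/2 — `HodgeFermat/DecodingDPrime.lean` (source l.21–66, verbatim) -/

set_option autoImplicit false

namespace HodgeFermat.KRFree.DecodingDPrime

open HodgeFermat.KRFree.LemmaN
open HodgeFermat.KRFree.TheoremUEq (ThmUPlus')
open HodgeFermat.KRFree.TheoremZ3U (KR6')

/-- **PROPOSITION D′ at the prime levels `3p`, `p ≥ 11`** (under `KR6'`, `ThmUPlus'`, and THEOREM F*(3p) as the hypothesis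
`hF` — discharged for `p ≠ 13` by `DecodingFinal.thmFstar hp hp11 hp13`; at `p = 13` the hypothesis is false, THEOREM D′(39)): two zero-sum triples mod `3p` with no entry `≡ 0 (mod 3p)`, jointly
primitive (no prime of `3p` divides all six entries) and DISJOINT mod `3p`, never have the same CM type. -/
theorem propDprime_prime (hKR : KR6') (hUplus : ThmUPlus') {p : ℕ} (hp : p.Prime) (hp11 : 11 ≤ p)
    (hF : ∀ {a b c a' b' c' : ℕ}, 3 * p ∣ a + b + c → 3 * p ∣ a' + b' + c' →
      Nat.Coprime a p → Nat.Coprime b p → Nat.Coprime c p → Nat.Coprime a' p → Nat.Coprime b' p → Nat.Coprime c' p →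
      (∀ u v, (u = a ∨ u = b ∨ u = c) → (v = a' ∨ v = b' ∨ v = c') → ¬ u ≡ v [MOD 3 * p]) →
      SameType (3 * p) (a, b, c) (a', b', c') → False)
    {a b c a' b' c' : ℕ}
    (hs : 3 * p ∣ a + b + c) (ha : ¬ 3 * p ∣ a) (hb : ¬ 3 * p ∣ b) (hc : ¬ 3 * p ∣ c)
    (hs' : 3 * p ∣ a' + b' + c') (ha' : ¬ 3 * p ∣ a') (hb' : ¬ 3 * p ∣ b') (hc' : ¬ 3 * p ∣ c')
    (hJ : ∀ q, Nat.Prime q → q ∣ 3 * p → q ∣ a → q ∣ b → q ∣ c → q ∣ a' → q ∣ b' → q ∣ c' → False)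
    (hD : ∀ u v, (u = a ∨ u = b ∨ u = c) → (v = a' ∨ v = b' ∨ v = c') → ¬ u ≡ v [MOD 3 * p])
    (hH : SameType (3 * p) (a, b, c) (a', b', c')) : False := by
  have h3p : Nat.Coprime 3 p := (Nat.coprime_primes Nat.prime_three hp).mpr (by omega)
  have hsq : Squarefree (3 * p) := (Nat.squarefree_mul h3p).mpr ⟨Nat.prime_three.prime.squarefree, hp.prime.squarefree⟩
  have hodd : Odd (3 * p) := Nat.odd_mul.mpr ⟨by decide, hp.odd_of_ne_two (by omega)⟩
  obtain ⟨-, h7, -⟩ := ThreeFinal.corollaryM_final hKR hUplus (3 * p) a b c a' b' c' hsq hodd hs ha hb hc hs' ha' hb' hc'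
    hJ hD hH
  obtain ⟨pa, pb, pc, pa', pb', pc'⟩ := h7 p hp (by omega) (Dvd.intro_left 3 rfl)
  have cop : ∀ {x : ℕ}, ¬ p ∣ x → Nat.Coprime x p := fun h => Nat.coprime_comm.mp ((Nat.Prime.coprime_iff_not_dvd hp).mpr h)
  exact hF hs hs' (cop pa) (cop pb) (cop pc) (cop pa') (cop pb') (cop pc') hD hH

/-- the same with "same CM type" as the conclusion's negation -/
theorem not_sameType (hKR : KR6') (hUplus : ThmUPlus') {p : ℕ} (hp : p.Prime) (hp11 : 11 ≤ p)
    (hF : ∀ {a b c a' b' c' : ℕ}, 3 * p ∣ a + b + c → 3 * p ∣ a' + b' + c' →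
      Nat.Coprime a p → Nat.Coprime b p → Nat.Coprime c p → Nat.Coprime a' p → Nat.Coprime b' p → Nat.Coprime c' p →
      (∀ u v, (u = a ∨ u = b ∨ u = c) → (v = a' ∨ v = b' ∨ v = c') → ¬ u ≡ v [MOD 3 * p]) →
      SameType (3 * p) (a, b, c) (a', b', c') → False)
    {a b c a' b' c' : ℕ}
    (hs : 3 * p ∣ a + b + c) (ha : ¬ 3 * p ∣ a) (hb : ¬ 3 * p ∣ b) (hc : ¬ 3 * p ∣ c)
    (hs' : 3 * p ∣ a' + b' + c') (ha' : ¬ 3 * p ∣ a') (hb' : ¬ 3 * p ∣ b') (hc' : ¬ 3 * p ∣ c')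
    (hJ : ∀ q, Nat.Prime q → q ∣ 3 * p → q ∣ a → q ∣ b → q ∣ c → q ∣ a' → q ∣ b' → q ∣ c' → False)
    (hD : ∀ u v, (u = a ∨ u = b ∨ u = c) → (v = a' ∨ v = b' ∨ v = c') → ¬ u ≡ v [MOD 3 * p]) :
    ¬ SameType (3 * p) (a, b, c) (a', b', c') :=
  fun hH => propDprime_prime hKR hUplus hp hp11 hF hs ha hb hc hs' ha' hb' hc' hJ hD hH

end HodgeFermat.KRFree.DecodingDPrime

/-! ## Module 2/2 — `HodgeFermat/DPrimePrimeFinal.lean` (source l.18–36, verbatim) + the closing theorem + source l.37–38 -/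

set_option autoImplicit false

namespace HodgeFermat.KRFree.DPrimePrimeFinal

open HodgeFermat.KRFree.LemmaN
open HodgeFermat.KRFree.TheoremUEq (ThmUPlus')
open HodgeFermat.KRFree.TheoremZ3U (KR6')

/-- **PROPOSITION D′ at the prime levels `3p`, `p ≥ 11`, `p ≠ 13`, under `KR6'` and `ThmUPlus'`.** -/
theorem propDprime_prime (hKR : KR6') (hUplus : ThmUPlus') {p : ℕ} (hp : p.Prime) (hp11 : 11 ≤ p) (hp13 : p ≠ 13)
    {a b c a' b' c' : ℕ}
    (hs : 3 * p ∣ a + b + c) (ha : ¬ 3 * p ∣ a) (hb : ¬ 3 * p ∣ b) (hc : ¬ 3 * p ∣ c)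
    (hs' : 3 * p ∣ a' + b' + c') (ha' : ¬ 3 * p ∣ a') (hb' : ¬ 3 * p ∣ b') (hc' : ¬ 3 * p ∣ c')
    (hJ : ∀ q, Nat.Prime q → q ∣ 3 * p → q ∣ a → q ∣ b → q ∣ c → q ∣ a' → q ∣ b' → q ∣ c' → False)
    (hD : ∀ u v, (u = a ∨ u = b ∨ u = c) → (v = a' ∨ v = b' ∨ v = c') → ¬ u ≡ v [MOD 3 * p])
    (hH : SameType (3 * p) (a, b, c) (a', b', c')) : False :=
  DecodingDPrime.propDprime_prime hKR hUplus hp hp11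
    (fun hs₁ hs₁' h₁ h₂ h₃ h₄ h₅ h₆ hD₁ hT₁ => DecodingFinal.thmFstar hp hp11 hp13 hs₁ hs₁' h₁ h₂ h₃ h₄ h₅ h₆ hD₁ hT₁)
    hs ha hb hc hs' ha' hb' hc' hJ hD hH

/-- **PROPOSITION D′ at the prime levels `3p`, `p ≥ 11`, `p ≠ 13` — holds**: the statement `PropDPrimePrime` filed first
(`HodgeFermatPropDPrimePrimeStatement.lean`, count-neutral) is closed by `propDprime_prime` above with THEOREM KR6 (`TheoremZ3U.kr6'`)
and THEOREM U⁺ (`PropDPrimeNFinal.thmUPlus'`) — theorems of `HodgeFermatPropDPrimeNFinal.lean` — for its two hypotheses (binders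
re-packaged, nothing else).  Unconditional: no hypothesis beyond the binders of the statement; axioms = [propext, Classical.choice,
Quot.sound]. -/
theorem propDprimePrime_holds : PropDPrimePrime :=
  fun _ hp hp11 hp13 _ _ _ _ _ _ hs ha hb hc hs' ha' hb' hc' hJ hD hH =>
    propDprime_prime TheoremZ3U.kr6' PropDPrimeNFinal.thmUPlus' hp hp11 hp13 hs ha hb hc hs' ha' hb' hc' hJ hD hH

end HodgeFermat.KRFree.DPrimePrimeFinal
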